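import Literature.NumberTheory.EllipticCurves.ModularFormsGamma0Rank
import Literature.NumberTheory.EllipticCurves.EisensteinSeriesNebentypus
import Mathlib.NumberTheory.DirichletCharacter.Orthogonality
import Mathlib.RingTheory.RootsOfUnity.AlgebraicallyClosed
import HarnessLib

/-!
# Explicit `ℂ[E₄, E₆]`-independent modular forms on `Γ₁(N)`: one block `E_4^χ · Δ^{μ-1-i}Δ_N^i`
# per even Dirichlet character `χ` (the rank input of the free-module route for `Γ₁(N)`)

For the free-module (Gannon / Marks–Mason) route to the dimension of `M_k(Γ)` — carried out for
`Γ = Γ₀(N)` in `ModularFormsGamma0FreeModule`, `ModularFormsGamma0Rank`, `ModularFormsGamma0Genus`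
(and `ModularFormsGamma0Dimension`) — the one level-specific input is a supply of `[SL₂(ℤ) : Γ]`
homogeneous forms on `Γ` of a common weight that are linearly independent over the ring
`R = M(SL₂(ℤ)) = ℂ[E₄, E₆]` ("rank `≥ [SL₂(ℤ) : Γ]`"). For `Γ₀(N)` these are the `μ = [SL₂(ℤ) : Γ₀(N)]`
forms `G_i = Δ^{μ-1-i}Δ_N^i`, `Δ_N = Δ ∣₁₂ diag(N,1)` (`explicitForm`, `explicitForm_indep`). This
file supplies them for the even-weight forms on **`Γ₁(N)`**: for every even Dirichlet character
`χ` modulo `N` and every `i < μ`,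

  `G_{χ,i} = E_4^χ · Δ^{μ-1-i}Δ_N^i ∈ M_{4 + 12(μ-1)}(Γ₁(N))`      (`charExplicitForm N χ i`),

with `E_4^χ = ∑_u χ(u)⁻¹ E_{4,(0,u)}` the weight-`4` Eisenstein series of nebentypus `χ`
(`EisensteinSeriesNebentypus.eisensteinChar`, of type `(4, χ)` on `Γ₀(N)` and `≢ 0` for even `χ`).

* `charExplicitForm_mem` — `G_{χ,i} ∈ M_{4+12(μ-1)}(Γ₁(N))` (as a function, `formSpace (Gamma1 N)`).
* `charExplicitForm_slash_of_mem_gamma0` — `(∑_i p_i G_{χ,i}) ∣ γ = χ(d) ∑_i p_i G_{χ,i}` for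
  level-one `p_i` and `γ ∈ Γ₀(N)`: each block has nebentypus `χ`.
* **`charExplicitForm_indep`** — for any finite set `s` of even characters, the family
  `(G_{χ,i})_{χ ∈ s, i < μ}` is independent over `R`: a relation `∑_χ ∑_i p_{χ,i} G_{χ,i} = 0` with
  level-one `p_{χ,i}` of a common weight splits by nebentypus
  (`eq_zero_of_sum_nebentypus_eq_zero`) into `E_4^χ · ∑_i p_{χ,i} G_i = 0` for each `χ`, the factor
  `E_4^χ ≢ 0` cancels by the identity theorem (`eq_zero_of_mul_eq_zero_of_mdifferentiable`), and
  `explicitForm_indep` gives `p_{χ,i} = 0`.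

With all `φ(N)/2` even characters (`N ≥ 3`) this is a family of `φ(N)μ/2 = [SL₂(ℤ) : ±Γ₁(N)]`
independent even-weight forms on `Γ₁(N)`, i.e. the rank lower bound for the graded
`ℂ[E₄, E₆]`-module `⊕_{k even} M_k(Γ₁(N))`; the counting of characters and the free-module /
determinant / cusp-count arguments themselves (verbatim those of the `Γ₀(N)` files, with
`SL₂(ℤ)/±Γ₁(N)` in place of `SL₂(ℤ)/Γ₀(N)` and no elliptic points for `N ≥ 4`) are deliberately not
repeated here. Everything is proved; no named facts.

## References

* T. Gannon, *The theory of vector-valued modular forms for the modular group*, Contrib. Math.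
  Comput. Sci. 8 (2014), 247–286, Thm. 3.4(a) and §3.5 (induced representations of finite-index
  subgroups).
* F. Diamond, J. Shurman, *A first course in modular forms*, GTM 228 (2005), §4.3 (decomposition
  of `M_k(Γ₁(N))` by nebentypus), §4.5–4.6 (`E_k^χ`).
-/

noncomputable section

open UpperHalfPlane hiding I
open ModularForm Complex Matrix.SpecialLinearGroup Filter CongruenceSubgroup
open scoped MatrixGroups ModularForm Topology Manifold

namespace Literature.NumberTheory.EllipticCurves.ModularForms

section Gamma1

variable (N : ℕ)

/-- `Γ₁(N) ≤ Γ₀(N)` inside `GL(2, ℝ)` (Mathlib `Gamma1_in_Gamma0`; a private copy of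
`gamma1_le_gamma0` of `NewformsProofs`, to keep the Hecke-operator files out of the imports). [folklore] -/
private theorem gamma1_le_gamma0_map :
    ((Gamma1 N : Subgroup SL(2, ℤ)) : Subgroup (GL (Fin 2) ℝ)) ≤ (Gamma0 N : Subgroup SL(2, ℤ)) :=
  Subgroup.map_mono (Gamma1_in_Gamma0 N)

variable [NeZero N]

/-- The space `M_k(Γ₁(N))` of weight-`k` forms on `Γ₁(N)`, as a space of functions. [folklore] -/
abbrev gamma1Space (k : ℤ) : Submodule ℂ (ℍ → ℂ) := formSpace (Gamma1 N) k

/-- `M_k(Γ₀(N)) ⊆ M_k(Γ₁(N))`. [folklore] -/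
theorem gamma0Space_le_gamma1Space (k : ℤ) : gamma0Space N k ≤ gamma1Space N k :=
  formSpace_mono (gamma1_le_gamma0_map N)

/-- **The explicit forms `G_{χ,i} = E_4^χ · Δ^{μ-1-i}Δ_N^i`** (`i < μ = [SL₂(ℤ) : Γ₀(N)]`), for a
Dirichlet character `χ` modulo `N`. [cite: Gannon2014, Thm. 3.4(a) and §3.5] -/
def charExplicitForm (χ : DirichletCharacter ℂ N) (i : Fin (gamma0Index N)) : ℍ → ℂ :=
  eisensteinChar N 4 χ * explicitForm N (gamma0Index N) i

/-- `G_{χ,i} ∈ M_{4 + 12(μ-1)}(Γ₁(N))`. [folklore] -/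
theorem charExplicitForm_mem (χ : DirichletCharacter ℂ N) (i : Fin (gamma0Index N)) :
    charExplicitForm N χ i ∈ gamma1Space N (4 + 12 * ((gamma0Index N : ℤ) - 1)) :=
  mul_mem_formSpace (coe_mem_formSpace (eisensteinCharMF N 4 χ (by norm_num)))
    (gamma0Space_le_gamma1Space N _ (explicitForm_mem N (gamma0Index N) i))

variable {N}

/-- A block `∑_i p_i G_{χ,i} = E_4^χ · ∑_i p_i G_i`. [folklore] -/
theorem sum_mul_charExplicitForm (χ : DirichletCharacter ℂ N)
    (p : Fin (gamma0Index N) → ℍ → ℂ) :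
    ∑ i, p i * charExplicitForm N χ i =
      eisensteinChar N 4 χ * ∑ i, p i * explicitForm N (gamma0Index N) i := by
  rw [Finset.mul_sum]
  refine Finset.sum_congr rfl fun i _ ↦ ?_
  rw [charExplicitForm]
  ring

/-- `∑_i p_i G_i ∈ M_{w + 12(μ-1)}(Γ₀(N))` for level-one `p_i` of weight `w`. [folklore] -/
theorem sum_mul_explicitForm_mem {w : ℤ} {p : Fin (gamma0Index N) → ℍ → ℂ}
    (hp : ∀ i, p i ∈ levelOneSpace w) :
    ∑ i, p i * explicitForm N (gamma0Index N) i ∈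
      gamma0Space N (w + 12 * ((gamma0Index N : ℤ) - 1)) :=
  Submodule.sum_mem _ fun i _ ↦ levelOne_mul_mem N (hp i) (explicitForm_mem N _ i)

/-- **Each block has nebentypus `χ`**: for level-one `p_i` of weight `w` and `γ = (a b; c d) ∈ Γ₀(N)`,
`(∑_i p_i G_{χ,i}) ∣_{4 + (w + 12(μ-1))} γ = χ(d) · ∑_i p_i G_{χ,i}` (`E_4^χ ∣ γ = χ(d)E_4^χ` and the
`Γ₀(N)`-invariance of `∑ p_i G_i`). [folklore] -/
theorem charExplicitForm_slash_of_mem_gamma0 (χ : DirichletCharacter ℂ N) {w : ℤ}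
    {p : Fin (gamma0Index N) → ℍ → ℂ} (hp : ∀ i, p i ∈ levelOneSpace w)
    {γ : SL(2, ℤ)} (hγ : γ ∈ Gamma0 N) :
    (∑ i, p i * charExplicitForm N χ i) ∣[4 + (w + 12 * ((gamma0Index N : ℤ) - 1))] γ =
      χ ((γ 1 1 : ℤ) : ZMod N) • ∑ i, p i * charExplicitForm N χ i := by
  have hg := slash_eq_of_mem_gamma0Space (sum_mul_explicitForm_mem (N := N) hp)
  rw [sum_mul_charExplicitForm, ModularForm.mul_slash_SL2, eisensteinChar_slash_of_mem_gamma0 hγ,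
    ModularForm.SL_slash, hg γ hγ, smul_mul_assoc]

/-- **`ℂ[E₄, E₆]`-independence of the forms `G_{χ,i}` over even characters**: if
`∑_{χ ∈ s} ∑_i p_{χ,i} G_{χ,i} = 0` with level-one `p_{χ,i}` of a common weight `w` and `s` a finite
set of even Dirichlet characters modulo `N`, then all `p_{χ,i} = 0`. (Split by nebentypus with
`eq_zero_of_sum_nebentypus_eq_zero`, cancel `E_4^χ ≢ 0` by the identity theorem, apply
`explicitForm_indep`.) [cite: Gannon2014, Thm. 3.4(a) and §3.5] -/
theorem charExplicitForm_indep (w : ℤ) (s : Finset (DirichletCharacter ℂ N))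
    (hs : ∀ χ ∈ s, χ.Even) (p : DirichletCharacter ℂ N → Fin (gamma0Index N) → ℍ → ℂ)
    (hp : ∀ χ ∈ s, ∀ i, p χ i ∈ levelOneSpace w)
    (h0 : ∑ χ ∈ s, ∑ i, p χ i * charExplicitForm N χ i = 0) :
    ∀ χ ∈ s, ∀ i, p χ i = 0 := by
  intro χ hχ
  -- split by nebentypus
  have hsplit := eq_zero_of_sum_nebentypus_eq_zero (k := 4 + (w + 12 * ((gamma0Index N : ℤ) - 1)))
    s (fun ψ ↦ ∑ i, p ψ i * charExplicitForm N ψ i)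
    (fun ψ hψ γ hγ ↦ charExplicitForm_slash_of_mem_gamma0 ψ (hp ψ hψ) hγ) h0 χ hχ
  -- cancel `E_4^χ`
  rw [sum_mul_charExplicitForm] at hsplit
  have hE : eisensteinChar N 4 χ ≠ 0 :=
    eisensteinChar_ne_zero (by norm_num) (by rw [hs χ hχ]; norm_num)
  have hcont : Continuous (∑ i, p χ i * explicitForm N (gamma0Index N) i) :=
    (mdifferentiable_of_mem_formSpace (sum_mul_explicitForm_mem (N := N) (hp χ hχ))).continuous
  have hzero := eq_zero_of_mul_eq_zero_of_mdifferentiable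
    (mdifferentiable_eisensteinChar (N := N) (χ := χ) (by norm_num)) hE hcont hsplit
  exact explicitForm_indep N w (p χ) (hp χ hχ) hzero

/-- The same independence for the family indexed by the pairs `(χ, i)`, `χ` ranging over a finite set
of even characters: a relation `∑_{(χ,i)} p_{(χ,i)} G_{χ,i} = 0` with level-one coefficients of a
common weight is trivial. [cite: Gannon2014, Thm. 3.4(a) and §3.5] -/
theorem charExplicitForm_indep' (w : ℤ) (s : Finset (DirichletCharacter ℂ N))
    (hs : ∀ χ ∈ s, χ.Even) (p : s × Fin (gamma0Index N) → ℍ → ℂ)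
    (hp : ∀ j, p j ∈ levelOneSpace w)
    (h0 : ∑ j, p j * charExplicitForm N j.1 j.2 = 0) : ∀ j, p j = 0 := by
  classical
  set P : DirichletCharacter ℂ N → Fin (gamma0Index N) → ℍ → ℂ :=
    fun χ i ↦ if h : χ ∈ s then p (⟨χ, h⟩, i) else 0 with hP
  have hP' : ∀ χ ∈ s, ∀ i, P χ i ∈ levelOneSpace w := fun χ hχ i ↦ by
    simp only [hP, dif_pos hχ]
    exact hp _
  have h0' : ∑ χ ∈ s, ∑ i, P χ i * charExplicitForm N χ i = 0 := by
    rw [← h0, Fintype.sum_prod_type, ← Finset.sum_coe_sort s]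
    refine Finset.sum_congr rfl fun χ _ ↦ Finset.sum_congr rfl fun i _ ↦ ?_
    simp only [hP, dif_pos χ.2]
  rintro ⟨χ, i⟩
  have := charExplicitForm_indep w s hs P hP' h0' χ χ.2 i
  simpa only [hP, dif_pos χ.2] using this

/-! ### All even characters: `φ(N)μ/2 = [SL₂(ℤ) : ±Γ₁(N)]` independent forms -/

open scoped Classical in
/-- **There are `φ(N)/2` even Dirichlet characters modulo `N ≥ 3`** (with values in `ℂ`):
`∑_χ χ(-1) = 0` for `-1 ≢ 1` (orthogonality, Mathlib `DirichletCharacter.sum_characters_eq`) and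
`χ(-1) = ±1`, while there are `φ(N)` characters in all
(`DirichletCharacter.card_eq_totient_of_hasEnoughRootsOfUnity`). [folklore] -/
theorem two_mul_card_even_dirichletCharacter (hN : 3 ≤ N) :
    2 * (Finset.univ.filter fun χ : DirichletCharacter ℂ N ↦ χ.Even).card = N.totient := by
  have hneg : (-1 : ZMod N) ≠ 1 := by
    intro h
    have h2 : (2 : ZMod N) = 0 := by linear_combination -h
    have hdvd : (N : ℕ) ∣ 2 := (ZMod.natCast_eq_zero_iff 2 N).mp (by exact_mod_cast h2)
    have := Nat.le_of_dvd (by norm_num) hdvd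
    omega
  have hsum := DirichletCharacter.sum_characters_eq (R := ℂ) (n := N) (-1 : ZMod N)
  rw [if_neg hneg] at hsum
  have hval : ∀ χ : DirichletCharacter ℂ N, χ (-1) = 1 ∨ χ (-1) = -1 := by
    intro χ
    have h1 : χ (-1) * χ (-1) = 1 := by
      rw [← map_mul]
      simp
    have : (χ (-1) - 1) * (χ (-1) + 1) = 0 := by linear_combination h1
    rcases mul_eq_zero.mp this with h | h
    · left; linear_combination h
    · right; linear_combination h
  have htot : (Finset.univ : Finset (DirichletCharacter ℂ N)).card = N.totient := by
    rw [Finset.card_univ, ← Nat.card_eq_fintype_card]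
    exact DirichletCharacter.card_eq_totient_of_hasEnoughRootsOfUnity ℂ N
  rw [← Finset.sum_filter_add_sum_filter_not Finset.univ
    (fun χ : DirichletCharacter ℂ N ↦ χ.Even)] at hsum
  have he : ∑ χ ∈ Finset.univ.filter (fun χ : DirichletCharacter ℂ N ↦ χ.Even), χ (-1) =
      (Finset.univ.filter fun χ : DirichletCharacter ℂ N ↦ χ.Even).card := by
    rw [Finset.card_eq_sum_ones, Nat.cast_sum, Nat.cast_one]
    exact Finset.sum_congr rfl fun χ hχ ↦ (Finset.mem_filter.mp hχ).2
  have ho : ∑ χ ∈ Finset.univ.filter (fun χ : DirichletCharacter ℂ N ↦ ¬ χ.Even), χ (-1) =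
      -(Finset.univ.filter fun χ : DirichletCharacter ℂ N ↦ ¬ χ.Even).card := by
    rw [Finset.card_eq_sum_ones, Nat.cast_sum, Nat.cast_one, ← Finset.sum_neg_distrib]
    refine Finset.sum_congr rfl fun χ hχ ↦ ?_
    have hne : ¬ χ (-1) = 1 := (Finset.mem_filter.mp hχ).2
    exact (hval χ).resolve_left hne
  rw [he, ho] at hsum
  have hcard := Finset.card_filter_add_card_filter_not
    (s := (Finset.univ : Finset (DirichletCharacter ℂ N))) (fun χ ↦ χ.Even)
  rw [htot] at hcard
  have h3 : ((Finset.univ.filter fun χ : DirichletCharacter ℂ N ↦ χ.Even).card : ℂ) =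
      (Finset.univ.filter fun χ : DirichletCharacter ℂ N ↦ ¬ χ.Even).card := by
    linear_combination hsum
  have h4 : (Finset.univ.filter fun χ : DirichletCharacter ℂ N ↦ χ.Even).card =
      (Finset.univ.filter fun χ : DirichletCharacter ℂ N ↦ ¬ χ.Even).card := by exact_mod_cast h3
  omega

variable (N) in
/-- The index set of the full family: pairs `(χ, i)` with `χ` an even Dirichlet character modulo `N`
and `i < μ`. [folklore] -/
abbrev EvenCharIndex : Type :=
  {χ : DirichletCharacter ℂ N // χ.Even} × Fin (gamma0Index N)

open scoped Classical in
/-- **The full family has `φ(N)μ/2` members** (`N ≥ 3`): `2 · #EvenCharIndex = φ(N) · μ`,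
i.e. `#EvenCharIndex = [SL₂(ℤ) : ±Γ₁(N)]` (`[SL₂(ℤ) : Γ₁(N)] = φ(N)μ`, and `-1 ∉ Γ₁(N)`).
[folklore] -/
theorem two_mul_card_evenCharIndex (hN : 3 ≤ N) :
    2 * Fintype.card (EvenCharIndex N) = N.totient * gamma0Index N := by
  rw [Fintype.card_prod, Fintype.card_fin, Fintype.card_subtype, ← mul_assoc,
    two_mul_card_even_dirichletCharacter hN]

open scoped Classical in
/-- **`ℂ[E₄, E₆]`-independence of the full family `(G_{χ,i})`, `χ` even, `i < μ`** — the rank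
lower bound `rank_R ⊕_{k even} M_k(Γ₁(N)) ≥ φ(N)μ/2 = [SL₂(ℤ) : ±Γ₁(N)]` of the free-module route
for `Γ₁(N)`. [cite: Gannon2014, Thm. 3.4(a) and §3.5] -/
theorem charExplicitForm_indep_even (w : ℤ) (p : EvenCharIndex N → ℍ → ℂ)
    (hp : ∀ j, p j ∈ levelOneSpace w)
    (h0 : ∑ j, p j * charExplicitForm N j.1.1 j.2 = 0) : ∀ j, p j = 0 := by
  classical
  set s : Finset (DirichletCharacter ℂ N) := Finset.univ.filter fun χ ↦ χ.Even with hs_def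
  have hs : ∀ χ ∈ s, χ.Even := fun χ hχ ↦ (Finset.mem_filter.mp hχ).2
  -- transport the family to the index set `s × Fin μ`
  let e : {χ : DirichletCharacter ℂ N // χ.Even} ≃ s :=
    { toFun := fun χ ↦ ⟨χ.1, Finset.mem_filter.mpr ⟨Finset.mem_univ _, χ.2⟩⟩
      invFun := fun χ ↦ ⟨χ.1, (Finset.mem_filter.mp χ.2).2⟩
      left_inv := fun χ ↦ rfl
      right_inv := fun χ ↦ rfl }
  set q : s × Fin (gamma0Index N) → ℍ → ℂ := fun j ↦ p (e.symm j.1, j.2) with hq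
  have hq' : ∀ j, q j ∈ levelOneSpace w := fun j ↦ hp _
  have h0' : ∑ j, q j * charExplicitForm N j.1 j.2 = 0 := by
    rw [← h0]
    exact Fintype.sum_equiv ((e.symm.prodCongr (Equiv.refl _))) _ _ fun j ↦ rfl
  intro j
  have := charExplicitForm_indep' w s hs q hq' h0' (e j.1, j.2)
  simpa [hq] using this

end Gamma1

end Literature.NumberTheory.EllipticCurves.ModularForms
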